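import Literature.LinearAlgebra.Matrix.BerkowitzAlgorithm
import Mathlib.LinearAlgebra.Matrix.ToLinearEquiv
import Mathlib.LinearAlgebra.Matrix.DotProduct
import Mathlib.LinearAlgebra.Dimension.Constructions
import Mathlib.Analysis.InnerProductSpace.PiL2
import HarnessLib

/-!
# Selecting short linearly independent lattice vectors: membership by Cramer, independence by Gram determinants

Topic `Literature/LinearAlgebra/Matrix`. The deterministic post-processing common to the lattice
reductions that call a SAMPLER polynomially many times and must output `n` linearly independent
lattice vectors as short as the samples allow (Regev 2009, Lemma 3.17, proof: *"look for a set of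
`n` linearly independent vectors in each of `S₀, …, S_{2n}`, and output the shortest set found"*),
written as total functional programs on integer matrices given as LISTS OF ROWS and parametrised by
a determinant routine `D : List (List ℤ) → ℤ` (any `D` that is the determinant on square row lists,
`DetCorrect D`; e.g. Berkowitz's `intDet`, or the polynomial-time `IntDetFP.detZ` of
`Computability/Complexity/DeterminantFP.lean`), together with their specifications:

* `memTest D B v` — **membership in the row lattice by Cramer's rule**: `det B ≠ 0` and
  `det B ∣ det (B with row i replaced by v)` for every `i`; `memTest_iff`: for a nonsingular square
  integer `B`, it holds iff `v = z ᵥ* B` for some `z ∈ ℤⁿ`.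
* `indepTest D T` — **independence by the Gram determinant** `det (T Tᵀ) ≠ 0`; `indepTest_rows_iff`
  from `linearIndependent_of_det_mul_transpose_ne_zero` (adjugate argument over `ℤ`) and
  `not_linearIndependent_of_det_mul_transpose_eq_zero` (a kernel vector `c ≠ 0` of `T Tᵀ` gives
  `‖Tᵀ c‖² = 0`, Mathlib `Matrix.exists_mulVec_eq_zero_iff`).
* `greedy D n S` — scan `S`, keep a vector when fewer than `n` are kept and the kept list stays
  independent; `greedy_sublist`, `length_greedy_le`, `linearIndependent_greedy`, and **completeness**
  `length_greedy_eq`: if the vectors of `S` span `ℝⁿ` then exactly `n` vectors are kept (every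
  rejected vector lies in the real span of the kept ones; `finrank_span_le_card`).
* `maxNormSq`, `selectBest` — the candidate with the least largest squared norm; `post D n B Bl Gs`
  — the candidates are the fallback `Bl` and, for each group `S ∈ Gs`, the greedy selection from the
  members of `S` that pass `memTest`, when it has `n` vectors; **`post_spec`**: the output consists
  of `n` linearly independent vectors of the row lattice of `B` whose largest squared norm is at
  most that of `Bl` and at most `max_{s ∈ S} ‖s‖²` for every group `S` of lattice vectors spanning
  `ℝⁿ` (`maxNormSq_post_le_of_group`).

Everything is proved; no named facts. All programs use only list primitives, integer arithmetic and
`D`, each polynomially often — the shape a `CodeFP` realisation needs (not in this file).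

## References

* O. Regev, *On lattices, learning with errors, random linear codes, and cryptography*, J. ACM 56
  (2009), art. 34, Lemma 3.17 (proof) [Regev2009] — the selection rule; the linear algebra is
  textbook (Cramer's rule; Gram determinants), everything is proved here.
* S. Lang, *Algebra*, rev. 3rd ed., Springer GTM 211, 2002, XIII §4 (Cramer's rule, Prop. 4.16) and
  XV §5 (Gram determinants) — cited for the method only.
-/

namespace Literature.LinearAlgebra.Matrix

namespace RowSelect

open _root_.Matrix Finset Berkowitz

/-! ### The programs -/

/-- The integer dot product of two lists (truncating). [folklore] -/
def idot (u v : List ℤ) : ℤ := dot (RingOps.ofRing ℤ) u v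

/-- The squared Euclidean norm of an integer list. [folklore] -/
def normSq (v : List ℤ) : ℤ := idot v v

/-- The Gram matrix `(⟨tᵢ, tⱼ⟩)ᵢⱼ` of a list of rows. [folklore] -/
def gram (T : List (List ℤ)) : List (List ℤ) := T.map fun u => T.map fun w => idot u w

variable (D : List (List ℤ) → ℤ)

/-- **`D` is a determinant routine**: on the row list of every square integer matrix it returns the
determinant (a predicate on `D`, e.g. satisfied by Berkowitz's `det (ofRing ℤ)`, `detCorrect_det`).
[folklore] -/
structure DetCorrect : Prop where
  /-- `D (rows M) = det M` for every square integer matrix `M`. -/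
  det_rows : ∀ {k : ℕ} (M : Matrix (Fin k) (Fin k) ℤ), D (rows M) = M.det

/-- Berkowitz's program over `ℤ` is a determinant routine. [cite: Berkowitz1984, §2] -/
theorem detCorrect_det : DetCorrect (Berkowitz.det (RingOps.ofRing ℤ)) := ⟨fun M => Berkowitz.det_rows M⟩

/-- **Independence test** by the Gram determinant: `det (T Tᵀ) ≠ 0`. [folklore] -/
def indepTest (T : List (List ℤ)) : Bool := decide (D (gram T) ≠ 0)

/-- **Membership test** in the row lattice of `B` by Cramer's rule: `det B ≠ 0` and `det B` divides
the determinant of `B` with any one row replaced by `v`. [folklore] -/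
def memTest (B : List (List ℤ)) (v : List ℤ) : Bool :=
  decide (D B ≠ 0) && (List.range B.length).all fun i => decide (D B ∣ D (B.set i v))

/-- One step of the greedy scan: keep `v` if fewer than `n` vectors are kept and independence is
preserved. [cite: Regev2009, Lemma 3.17 (proof)] -/
def greedyStep (n : ℕ) (T : List (List ℤ)) (v : List ℤ) : List (List ℤ) :=
  if decide (T.length < n) && indepTest D (T ++ [v]) then T ++ [v] else T

/-- **Greedy selection** of at most `n` independent vectors from `S`, in order. [cite: Regev2009, Lemma 3.17 (proof)] -/
def greedy (n : ℕ) (S : List (List ℤ)) : List (List ℤ) := S.foldl (greedyStep D n) []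

/-- The largest squared norm in a list of vectors (`0` for the empty list). [folklore] -/
def maxNormSq (T : List (List ℤ)) : ℤ := (T.map normSq).foldl max 0

/-- Keep the strictly better (smaller largest squared norm) of a new candidate and the incumbent.
[cite: Regev2009, Lemma 3.17 (proof: "output the shortest set found")] -/
def better (C best : List (List ℤ)) : List (List ℤ) := if maxNormSq C < maxNormSq best then C else best

/-- **The shortest set found**, starting from the fallback `c₀`. [cite: Regev2009, Lemma 3.17 (proof)] -/
def selectBest (c₀ : List (List ℤ)) (cands : List (List (List ℤ))) : List (List ℤ) :=
  cands.foldl (fun best C => better C best) c₀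

/-- The candidate of a group: the greedy selection from its members of the row lattice of `B`.
[cite: Regev2009, Lemma 3.17 (proof: "look for a set of n linearly independent vectors in each Sᵢ")] -/
def groupCandidate (n : ℕ) (B S : List (List ℤ)) : List (List ℤ) := greedy D n (S.filter (memTest D B))

/-- The admissible candidates: group candidates with exactly `n` vectors. [cite: Regev2009, Lemma 3.17 (proof)] -/
def candidates (n : ℕ) (B : List (List ℤ)) (Gs : List (List (List ℤ))) : List (List (List ℤ)) :=
  (Gs.map (groupCandidate D n B)).filter fun T => decide (T.length = n)

/-- **The post-processing**: the shortest among the fallback `Bl` and the admissible group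
candidates. [cite: Regev2009, Lemma 3.17 (proof)] -/
def post (n : ℕ) (B Bl : List (List ℤ)) (Gs : List (List (List ℤ))) : List (List ℤ) :=
  selectBest Bl (candidates D n B Gs)

/-! ### Dot products, Gram matrices, norms -/

/-- `idot` of two `List.ofFn` is the dot product. [folklore] -/
theorem idot_ofFn {n : ℕ} (u v : Fin n → ℤ) : idot (List.ofFn u) (List.ofFn v) = u ⬝ᵥ v := dot_ofFn u v

/-- `normSq` of `List.ofFn v` is `v ⬝ᵥ v`. [folklore] -/
theorem normSq_ofFn {n : ℕ} (v : Fin n → ℤ) : normSq (List.ofFn v) = v ⬝ᵥ v := idot_ofFn v v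

/-- The Gram list of a row list is the row list of `T Tᵀ`. [folklore] -/
theorem gram_rows {k n : ℕ} (T : Matrix (Fin k) (Fin n) ℤ) : gram (rows T) = rows (T * Tᵀ) := by
  simp only [gram, rows, List.map_ofFn]
  congr 1
  funext i
  simp only [Function.comp_apply]
  congr 1
  funext j
  rw [Function.comp_apply, idot_ofFn, Matrix.mul_apply']
  rfl

/-! ### The independence test -/

/-- **Soundness of the Gram test**: `det (T Tᵀ) ≠ 0` makes the rows of `T` linearly independent
over `ℤ` (from `∑ cᵢ tᵢ = 0`: `det (T Tᵀ) • c = adj(T Tᵀ) (T Tᵀ) c = adj(T Tᵀ) T (Tᵀ c) = 0`).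
[folklore] -/
theorem linearIndependent_of_det_mul_transpose_ne_zero {k n : ℕ} (T : Matrix (Fin k) (Fin n) ℤ)
    (h : (T * Tᵀ).det ≠ 0) : LinearIndependent ℤ (fun i => T i) := by
  rw [Fintype.linearIndependent_iff]
  intro c hc i
  have hcT : c ᵥ* T = 0 := by rw [Matrix.vecMul_eq_sum]; exact hc
  have h1 : (T * Tᵀ) *ᵥ c = 0 := by
    rw [← Matrix.mulVec_mulVec, Matrix.mulVec_transpose, hcT, Matrix.mulVec_zero]
  have h2 : (T * Tᵀ).det • c = 0 := by
    have := congrArg (fun w => (T * Tᵀ).adjugate *ᵥ w) h1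
    simp only [Matrix.mulVec_mulVec, Matrix.adjugate_mul, Matrix.mulVec_zero, Matrix.smul_mulVec,
      Matrix.one_mulVec] at this
    exact this
  have := congrFun h2 i
  simp only [Pi.smul_apply, smul_eq_mul, Pi.zero_apply, mul_eq_zero] at this
  exact this.resolve_left h

/-- **Completeness of the Gram test**: if `det (T Tᵀ) = 0` then the rows of `T` are linearly
dependent over `ℤ` (a kernel vector `c ≠ 0` of `T Tᵀ` has `‖Tᵀ c‖² = cᵀ T Tᵀ c = 0`).
[folklore] -/
theorem not_linearIndependent_of_det_mul_transpose_eq_zero {k n : ℕ} (T : Matrix (Fin k) (Fin n) ℤ)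
    (h : (T * Tᵀ).det = 0) : ¬ LinearIndependent ℤ (fun i => T i) := by
  obtain ⟨c, hc0, hc⟩ := Matrix.exists_mulVec_eq_zero_iff.2 h
  have h1 : (c ᵥ* T) ⬝ᵥ (c ᵥ* T) = 0 := by
    have : c ⬝ᵥ ((T * Tᵀ) *ᵥ c) = 0 := by rw [hc, dotProduct_zero]
    rwa [← Matrix.mulVec_mulVec, Matrix.mulVec_transpose, Matrix.dotProduct_mulVec] at this
  rw [dotProduct_self_eq_zero] at h1
  rw [Fintype.linearIndependent_iff]
  intro hli
  apply hc0
  funext i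
  exact hli c (by rw [← Matrix.vecMul_eq_sum]; exact h1) i

variable {D}

/-- The Gram test decides linear independence of the rows (for a determinant routine `D`).
[folklore] -/
theorem indepTest_rows_iff (hD : DetCorrect D) {k n : ℕ} (T : Matrix (Fin k) (Fin n) ℤ) :
    indepTest D (rows T) = true ↔ LinearIndependent ℤ (fun i => T i) := by
  rw [indepTest, gram_rows, hD.det_rows, decide_eq_true_iff]
  exact ⟨linearIndependent_of_det_mul_transpose_ne_zero T, fun h hdet =>
    not_linearIndependent_of_det_mul_transpose_eq_zero T hdet h⟩

/-! ### The membership test -/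

/-- Replacing item `i` of a row list replaces row `i`. [folklore] -/
theorem rows_set {k n : ℕ} (M : Matrix (Fin k) (Fin n) ℤ) (i : Fin k) (v : Fin n → ℤ) :
    (rows M).set i (List.ofFn v) = rows (M.updateRow i v) := by
  simp only [rows]
  apply List.ext_getElem
  · simp
  · intro j h₁ h₂
    have hj : j < k := by simpa using h₂
    simp only [List.getElem_set, List.getElem_ofFn]
    by_cases hij : (i : ℕ) = j
    · have hji : (⟨j, hj⟩ : Fin k) = i := Fin.ext hij.symm
      rw [if_pos hij, hji, Matrix.updateRow_self]
    · rw [if_neg hij, Matrix.updateRow_ne]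
      exact fun h => hij (by rw [← h])

/-- **Cramer's rule for the row lattice.** For a nonsingular square integer matrix `B` and an
integer vector `v`: `v = z ᵥ* B` for some `z ∈ ℤⁿ` iff `det B` divides
`det (B with row i replaced by v)` for every `i`. (`⇒`: `cramer Bᵀ (B i) = det B · eᵢ` and
linearity; `⇐`: `Bᵀ (cramer Bᵀ v) = det B · v`, so `det B · (z ᵥ* B) = det B · v` for the
quotients `z`, and `ℤⁿ` is torsion-free.) [folklore] -/
theorem exists_vecMul_eq_iff_forall_dvd {n : ℕ} (B : Matrix (Fin n) (Fin n) ℤ) (hB : B.det ≠ 0)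
    (v : Fin n → ℤ) : (∃ z : Fin n → ℤ, z ᵥ* B = v) ↔ ∀ i, B.det ∣ (B.updateRow i v).det := by
  have hcr : ∀ i, (B.updateRow i v).det = Bᵀ.cramer v i := fun i => by
    rw [Matrix.cramer_apply, Matrix.updateCol_transpose, Matrix.det_transpose]
  constructor
  · rintro ⟨z, rfl⟩ i
    rw [hcr, Matrix.vecMul_eq_sum, map_sum]
    simp only [map_zsmul, Matrix.cramer_transpose_row_self, Finset.sum_apply, Pi.smul_apply,
      Pi.single_apply, smul_eq_mul, mul_ite, mul_zero, Finset.sum_ite_eq, Finset.mem_univ, if_true]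
    exact Dvd.intro_left _ rfl
  · intro h
    choose z hz using h
    refine ⟨z, ?_⟩
    have h1 : Bᵀ *ᵥ Bᵀ.cramer v = B.det • v := by rw [Matrix.mulVec_cramer, Matrix.det_transpose]
    have h2 : Bᵀ.cramer v = B.det • z := by
      funext i; rw [← hcr, hz i, Pi.smul_apply, smul_eq_mul]
    rw [h2, Matrix.mulVec_smul, Matrix.mulVec_transpose] at h1
    exact smul_right_injective _ hB h1

/-- **The membership test is correct** (for a determinant routine `D`): on the row list of a
nonsingular square integer matrix `B`, `memTest D (rows B) (List.ofFn v)` holds iff `v` is an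
integer combination of the rows. [folklore] -/
theorem memTest_iff (hD : DetCorrect D) {n : ℕ} (B : Matrix (Fin n) (Fin n) ℤ) (hB : B.det ≠ 0)
    (v : Fin n → ℤ) : memTest D (rows B) (List.ofFn v) = true ↔ ∃ z : Fin n → ℤ, z ᵥ* B = v := by
  rw [exists_vecMul_eq_iff_forall_dvd B hB, memTest, Bool.and_eq_true, decide_eq_true_iff, hD.det_rows,
    List.all_eq_true, length_rows]
  constructor
  · rintro ⟨-, h⟩ i
    have := h i (List.mem_range.2 i.isLt)
    rwa [decide_eq_true_iff, rows_set, hD.det_rows] at this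
  · intro h
    refine ⟨hB, fun i hi => ?_⟩
    rw [List.mem_range] at hi
    rw [decide_eq_true_iff]
    have := h ⟨i, hi⟩
    rwa [← hD.det_rows (B.updateRow ⟨i, hi⟩ v), ← rows_set] at this

/-- A vector passing the membership test has the right length's worth of structure: it is the
`List.ofFn` of an integer combination of the rows (when it has length `n`). [folklore] -/
theorem exists_of_memTest (hD : DetCorrect D) {n : ℕ} (B : Matrix (Fin n) (Fin n) ℤ) (hB : B.det ≠ 0)
    {v : List ℤ} (hv : v.length = n) (h : memTest D (rows B) v = true) :
    ∃ z : Fin n → ℤ, List.ofFn (z ᵥ* B) = v := by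
  obtain ⟨w, rfl⟩ : ∃ w : Fin n → ℤ, v = List.ofFn w := ⟨fun i => v.get (i.cast hv.symm), by
    apply List.ext_getElem <;> simp [hv]⟩
  obtain ⟨z, hz⟩ := (memTest_iff hD B hB w).1 h
  exact ⟨z, by rw [hz]⟩

/-! ### The greedy selection -/

section Greedy

variable (D) (n : ℕ)

/-- The greedy selection keeps a sublist of the scanned vectors. [folklore] -/
theorem greedy_sublist (S : List (List ℤ)) : (greedy D n S).Sublist S := by
  suffices h : ∀ (S T : List (List ℤ)), (S.foldl (greedyStep D n) T).Sublist (T ++ S) by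
    simpa [greedy] using h S []
  intro S
  induction S with
  | nil => intro T; simp
  | cons v S ih =>
    intro T
    rw [List.foldl_cons]
    refine (ih _).trans ?_
    unfold greedyStep
    split_ifs
    · simp
    · simp

/-- Invariant of the scan: the kept list is empty or passes the independence test. [folklore] -/
theorem greedy_indepTest (S : List (List ℤ)) : greedy D n S = [] ∨ indepTest D (greedy D n S) = true := by
  suffices h : ∀ (S T : List (List ℤ)), (T = [] ∨ indepTest D T = true) →
      S.foldl (greedyStep D n) T = [] ∨ indepTest D (S.foldl (greedyStep D n) T) = true from
    h S [] (Or.inl rfl)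
  intro S
  induction S with
  | nil => intro T hT; exact hT
  | cons v S ih =>
    intro T hT
    rw [List.foldl_cons]
    apply ih
    unfold greedyStep
    split_ifs with h
    · simp only [Bool.and_eq_true] at h
      exact Or.inr h.2
    · exact hT

end Greedy

/-- A list of `k` vectors of length `n` is the row list of a `k × n` matrix. [folklore] -/
theorem exists_rows {n k : ℕ} (T : List (List ℤ)) (hk : T.length = k) (hT : ∀ v ∈ T, v.length = n) :
    ∃ M : Matrix (Fin k) (Fin n) ℤ, rows M = T := by
  subst hk
  refine ⟨fun i j => (T.get i).get (j.cast (hT _ (List.get_mem T i)).symm), ?_⟩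
  apply List.ext_getElem (by simp [rows])
  intro i h₁ h₂
  simp only [rows, List.getElem_ofFn]
  apply List.ext_getElem (by simp [hT _ (List.getElem_mem h₂)])
  intro j h₃ h₄
  simp

/-- **Soundness of the greedy selection**: the kept vectors are linearly independent over `ℤ`
(as the rows of any matrix with that row list). [cite: Regev2009, Lemma 3.17 (proof)] -/
theorem linearIndependent_greedy (hD : DetCorrect D) {n k : ℕ} (S : List (List ℤ))
    (M : Matrix (Fin k) (Fin n) ℤ) (hM : rows M = greedy D n S) : LinearIndependent ℤ (fun i => M i) := by
  rcases greedy_indepTest D n S with h | h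
  · have hk : k = 0 := by rw [← length_rows M, hM, h]; rfl
    subst hk
    exact linearIndependent_empty_type
  · rw [← hM, indepTest_rows_iff hD] at h
    exact h

/-- The real span of the casts of a list of integer vectors of length `n`. [folklore] -/
def realSpan (n : ℕ) (T : List (List ℤ)) : Submodule ℝ (Fin n → ℝ) :=
  Submodule.span ℝ {x | ∃ v ∈ T, ∃ w : Fin n → ℤ, List.ofFn w = v ∧ x = fun j => (w j : ℝ)}

/-- The cast of a listed vector lies in the real span. [folklore] -/
theorem cast_mem_realSpan {n : ℕ} {T : List (List ℤ)} {w : Fin n → ℤ} (h : List.ofFn w ∈ T) :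
    (fun j => (w j : ℝ)) ∈ realSpan n T :=
  Submodule.subset_span ⟨_, h, w, rfl, rfl⟩

/-- The real span is monotone. [folklore] -/
theorem realSpan_mono {n : ℕ} {T T' : List (List ℤ)} (h : ∀ v ∈ T, v ∈ T') : realSpan n T ≤ realSpan n T' :=
  Submodule.span_mono fun _ ⟨v, hv, w, hw, hx⟩ => ⟨v, h v hv, w, hw, hx⟩

/-- `realSpan` of an append is contained in a submodule containing both parts. [folklore] -/
theorem realSpan_append_le {n : ℕ} {T₁ T₂ : List (List ℤ)} {N : Submodule ℝ (Fin n → ℝ)}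
    (h₁ : realSpan n T₁ ≤ N) (h₂ : realSpan n T₂ ≤ N) : realSpan n (T₁ ++ T₂) ≤ N := by
  refine Submodule.span_le.2 ?_
  rintro x ⟨v, hv, w, hw, rfl⟩
  rw [List.mem_append] at hv
  rcases hv with hv | hv
  · exact h₁ (Submodule.subset_span ⟨v, hv, w, hw, rfl⟩)
  · exact h₂ (Submodule.subset_span ⟨v, hv, w, hw, rfl⟩)

/-- The real span of a row list is spanned by (at most) as many vectors as rows. [folklore] -/
theorem finrank_realSpan_le {n k : ℕ} (T : List (List ℤ)) (M : Matrix (Fin k) (Fin n) ℤ) (hM : rows M = T) :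
    Module.finrank ℝ (realSpan n T) ≤ k := by
  have hle : realSpan n T ≤ Submodule.span ℝ (Set.range fun i : Fin k => fun j => (M i j : ℝ)) := by
    refine Submodule.span_le.2 ?_
    rintro x ⟨v, hv, w, hw, rfl⟩
    rw [← hM, rows, List.mem_ofFn] at hv
    obtain ⟨i, hi⟩ := hv
    have : w = M i := List.ofFn_injective (hw.trans hi.symm)
    subst this
    exact Submodule.subset_span ⟨i, rfl⟩
  calc Module.finrank ℝ (realSpan n T)
      ≤ Module.finrank ℝ (Submodule.span ℝ (Set.range fun i : Fin k => fun j => (M i j : ℝ))) :=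
        Submodule.finrank_mono hle
    _ ≤ Fintype.card (Fin k) := finrank_range_le_card _
    _ = k := Fintype.card_fin k

/-- A rejected vector, scanned while fewer than `n` are kept, lies in the real span of the kept
vectors: the kept list with it appended is `ℤ`-dependent (`indepTest` is complete), the kept list is
independent (`indepTest` is sound), so its coefficient is nonzero and one solves for it over `ℝ`.
[cite: Regev2009, Lemma 3.17 (proof)] -/
theorem mem_realSpan_of_reject (hD : DetCorrect D) {n : ℕ} {T : List (List ℤ)} {v : List ℤ}
    (hT : ∀ u ∈ T, u.length = n) (hv : v.length = n) (hTi : T = [] ∨ indepTest D T = true)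
    (hrej : indepTest D (T ++ [v]) = false) :
    ∃ w : Fin n → ℤ, List.ofFn w = v ∧ (fun j => (w j : ℝ)) ∈ realSpan n T := by
  classical
  obtain ⟨M, hM⟩ := exists_rows (T ++ [v]) (k := T.length + 1) (by simp) (fun u hu => by
    simp only [List.mem_append, List.mem_singleton] at hu
    rcases hu with hu | rfl
    · exact hT u hu
    · exact hv)
  -- the rows of `M`: the first `|T|` list `T`, the last is `v`
  have hsplit := hM
  rw [rows, List.ofFn_succ_last] at hsplit
  obtain ⟨hrowT, hrowv⟩ := List.append_inj' hsplit (by simp)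
  rw [List.cons.injEq] at hrowv
  replace hrowv := hrowv.1
  -- dependence of all rows, independence of the first `|T|`
  have hdep : ¬ LinearIndependent ℤ (fun i => M i) := by
    rw [← indepTest_rows_iff hD, hM, hrej]; exact Bool.false_ne_true
  rw [Fintype.not_linearIndependent_iff] at hdep
  obtain ⟨c, hc, i₀, hi₀⟩ := hdep
  have hTind : ∀ d : Fin T.length → ℤ, ∑ i, d i • M (Fin.castSucc i) = 0 → ∀ i, d i = 0 := by
    have hMT : rows (M.submatrix Fin.castSucc id) = T := hrowT
    rcases hTi with hTi | hTi
    · intro d _ i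
      have : T.length = 0 := by rw [hTi]; rfl
      exact (Fin.cast this i).elim0
    · have hind := (indepTest_rows_iff hD (M.submatrix Fin.castSucc id)).1 (by rw [hMT]; exact hTi)
      rw [Fintype.linearIndependent_iff] at hind
      exact hind
  have hcl0 : c (Fin.last T.length) ≠ 0 := by
    intro h0
    rw [Fin.sum_univ_castSucc, h0, zero_smul, add_zero] at hc
    have hall := hTind _ hc
    apply hi₀
    induction i₀ using Fin.lastCases with
    | last => exact h0
    | cast j => exact hall j
  refine ⟨M (Fin.last T.length), hrowv, ?_⟩
  -- cast the relation to `ℝ` and solve for the last row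
  have hcR : ∑ i : Fin (T.length + 1), (c i : ℝ) • (fun j => (M i j : ℝ)) = 0 := by
    funext j
    have hj := congrArg (fun w : Fin n → ℤ => (w j : ℝ)) hc
    simp only [Finset.sum_apply, Pi.smul_apply, smul_eq_mul, Pi.zero_apply, Int.cast_sum,
      Int.cast_mul, Int.cast_zero] at hj ⊢
    exact hj
  rw [Fin.sum_univ_castSucc] at hcR
  have hclR : (c (Fin.last T.length) : ℝ) ≠ 0 := by exact_mod_cast hcl0
  have hv_eq : (fun j => (M (Fin.last T.length) j : ℝ)) =
      -((c (Fin.last T.length) : ℝ)⁻¹ • ∑ i : Fin T.length, (c (Fin.castSucc i) : ℝ) •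
        (fun j => (M (Fin.castSucc i) j : ℝ))) := by
    have h1 : (c (Fin.last T.length) : ℝ) • (fun j => (M (Fin.last T.length) j : ℝ)) =
        -∑ i : Fin T.length, (c (Fin.castSucc i) : ℝ) • (fun j => (M (Fin.castSucc i) j : ℝ)) :=
      eq_neg_of_add_eq_zero_right hcR
    calc (fun j => (M (Fin.last T.length) j : ℝ))
        = (c (Fin.last T.length) : ℝ)⁻¹ • ((c (Fin.last T.length) : ℝ) • fun j => (M (Fin.last T.length) j : ℝ)) := by
          rw [inv_smul_smul₀ hclR]
      _ = _ := by rw [h1, smul_neg]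
  rw [hv_eq]
  refine Submodule.neg_mem _ (Submodule.smul_mem _ _ (Submodule.sum_mem _ fun i _ =>
    Submodule.smul_mem _ _ (cast_mem_realSpan ?_)))
  have e := List.getElem_of_eq hrowT.symm i.isLt
  rw [List.getElem_ofFn] at e
  have hm := List.getElem_mem (l := T) i.isLt
  rw [e] at hm
  exact hm

/-- **The scan with its invariants**: kept vectors have length `n`, pass the independence test, are
at most `n`, and — as long as fewer than `n` are kept — their real span contains every scanned
vector. [cite: Regev2009, Lemma 3.17 (proof)] -/
theorem greedy_invariant (hD : DetCorrect D) {n : ℕ} :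
    ∀ (S₂ S₁ T : List (List ℤ)), (∀ v ∈ S₂, v.length = n) →
      (∀ u ∈ T, u.length = n) → (T = [] ∨ indepTest D T = true) → T.length ≤ n →
      (T.length < n → realSpan n S₁ ≤ realSpan n T) →
      let T' := S₂.foldl (greedyStep D n) T
      (∀ u ∈ T', u.length = n) ∧ T'.length ≤ n ∧ (T'.length < n → realSpan n (S₁ ++ S₂) ≤ realSpan n T') := by
  intro S₂
  induction S₂ with
  | nil =>
    intro S₁ T _ hTl _ hTn hsp
    exact ⟨hTl, hTn, fun h => by simpa using hsp h⟩
  | cons v S₂ ih =>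
    intro S₁ T hS hTl hTi hTn hsp
    rw [List.foldl_cons]
    have hv : v.length = n := hS v List.mem_cons_self
    have hS₂ : ∀ u ∈ S₂, u.length = n := fun u hu => hS u (List.mem_cons_of_mem v hu)
    have happ : S₁ ++ v :: S₂ = (S₁ ++ [v]) ++ S₂ := by simp
    rw [happ]
    unfold greedyStep
    split_ifs with hacc
    · -- accepted
      simp only [Bool.and_eq_true, decide_eq_true_iff] at hacc
      refine ih (S₁ ++ [v]) (T ++ [v]) hS₂ (fun u hu => ?_) (Or.inr hacc.2) (by simp; omega) (fun hlt => ?_)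
      · simp only [List.mem_append, List.mem_singleton] at hu
        rcases hu with hu | rfl
        · exact hTl u hu
        · exact hv
      · have hTv : realSpan n T ≤ realSpan n (T ++ [v]) := realSpan_mono fun u hu => List.mem_append_left _ hu
        exact realSpan_append_le ((hsp hacc.1).trans hTv) (realSpan_mono fun u hu => List.mem_append_right _ hu)
    · -- rejected
      simp only [Bool.and_eq_true, decide_eq_true_iff, not_and] at hacc
      refine ih (S₁ ++ [v]) T hS₂ hTl hTi hTn (fun hlt => ?_)
      have hrej : indepTest D (T ++ [v]) = false := by simpa using hacc hlt
      obtain ⟨w, hw, hwT⟩ := mem_realSpan_of_reject hD hTl hv hTi hrej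
      refine realSpan_append_le (hsp hlt) (Submodule.span_le.2 ?_)
      rintro x ⟨u, hu, w', hw', rfl⟩
      rw [List.mem_singleton] at hu
      subst hu
      have : w' = w := List.ofFn_injective (hw'.trans hw.symm)
      subst this
      exact hwT

/-- The kept vectors have length `n` (when all scanned vectors do). [folklore] -/
theorem forall_length_greedy (hD : DetCorrect D) {n : ℕ} (S : List (List ℤ)) (hS : ∀ v ∈ S, v.length = n) :
    ∀ u ∈ greedy D n S, u.length = n :=
  (greedy_invariant hD S [] [] hS (by simp) (Or.inl rfl) (Nat.zero_le n) (fun _ => by simp [realSpan])).1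

/-- At most `n` vectors are kept. [folklore] -/
theorem length_greedy_le (hD : DetCorrect D) {n : ℕ} (S : List (List ℤ)) (hS : ∀ v ∈ S, v.length = n) :
    (greedy D n S).length ≤ n :=
  (greedy_invariant hD S [] [] hS (by simp) (Or.inl rfl) (Nat.zero_le n) (fun _ => by simp [realSpan])).2.1

/-- **Completeness of the greedy selection**: if the scanned vectors (all of length `n`) span
`ℝⁿ`, exactly `n` of them are kept (otherwise `ℝⁿ` would be spanned by fewer than `n` vectors).
[cite: Regev2009, Lemma 3.17 (proof)] -/
theorem length_greedy_eq (hD : DetCorrect D) {n : ℕ} (S : List (List ℤ)) (hS : ∀ v ∈ S, v.length = n)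
    (hspan : realSpan n S = ⊤) : (greedy D n S).length = n := by
  obtain ⟨hl, hle, hsp⟩ := greedy_invariant hD S [] [] hS (by simp) (Or.inl rfl) (Nat.zero_le n)
    (fun _ => by simp [realSpan])
  have hsp' : (greedy D n S).length < n → realSpan n S ≤ realSpan n (greedy D n S) := fun h => by
    have h' := hsp h
    rw [List.nil_append] at h'
    exact h'
  refine le_antisymm hle (not_lt.1 fun hlt => ?_)
  have htop : (⊤ : Submodule ℝ (Fin n → ℝ)) ≤ realSpan n (greedy D n S) := by
    rw [← hspan]; exact hsp' hlt
  obtain ⟨M, hM⟩ := exists_rows (greedy D n S) rfl hl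
  have h1 := finrank_realSpan_le _ M hM
  have h2 : Module.finrank ℝ (⊤ : Submodule ℝ (Fin n → ℝ)) ≤ Module.finrank ℝ (realSpan n (greedy D n S)) :=
    Submodule.finrank_mono htop
  rw [finrank_top, Module.finrank_fin_fun] at h2
  change (greedy D n S).length < n at hlt
  omega

/-! ### The selection of the shortest candidate -/

/-- `maxNormSq` bounds every squared norm in the list. [folklore] -/
theorem normSq_le_maxNormSq {T : List (List ℤ)} {v : List ℤ} (h : v ∈ T) : normSq v ≤ maxNormSq T := by
  rw [maxNormSq]
  have key : ∀ (l : List ℤ) (a : ℤ), a ≤ l.foldl max a ∧ ∀ x ∈ l, x ≤ l.foldl max a := by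
    intro l
    induction l with
    | nil => intro a; simp
    | cons y l ih =>
      intro a
      rw [List.foldl_cons]
      obtain ⟨h1, h2⟩ := ih (max a y)
      refine ⟨(le_max_left a y).trans h1, fun x hx => ?_⟩
      rw [List.mem_cons] at hx
      rcases hx with rfl | hx
      · exact (le_max_right a x).trans h1
      · exact h2 x hx
  exact (key _ 0).2 _ (List.mem_map.2 ⟨v, h, rfl⟩)

/-- `maxNormSq` is the least such bound among nonnegative numbers. [folklore] -/
theorem maxNormSq_le {T : List (List ℤ)} {b : ℤ} (hb : 0 ≤ b) (h : ∀ v ∈ T, normSq v ≤ b) : maxNormSq T ≤ b := by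
  rw [maxNormSq]
  have key : ∀ (l : List ℤ) (a : ℤ), a ≤ b → (∀ x ∈ l, x ≤ b) → l.foldl max a ≤ b := by
    intro l
    induction l with
    | nil => intro a ha _; simpa using ha
    | cons y l ih =>
      intro a ha hl
      rw [List.foldl_cons]
      exact ih _ (max_le ha (hl y List.mem_cons_self)) fun x hx => hl x (List.mem_cons_of_mem y hx)
  exact key _ 0 hb fun x hx => by
    obtain ⟨v, hv, rfl⟩ := List.mem_map.1 hx
    exact h v hv

/-- `selectBest` returns the fallback or one of the candidates. [folklore] -/
theorem selectBest_mem (c₀ : List (List ℤ)) (cands : List (List (List ℤ))) :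
    selectBest c₀ cands = c₀ ∨ selectBest c₀ cands ∈ cands := by
  suffices h : ∀ (cands : List (List (List ℤ))) (b : List (List ℤ)),
      cands.foldl (fun best C => better C best) b = b ∨ cands.foldl (fun best C => better C best) b ∈ cands from
    h cands c₀
  intro cands
  induction cands with
  | nil => intro b; simp
  | cons C cands ih =>
    intro b
    rw [List.foldl_cons]
    rcases ih (better C b) with h | h
    · rw [h, better]
      split_ifs
      · exact Or.inr List.mem_cons_self
      · exact Or.inl rfl
    · exact Or.inr (List.mem_cons_of_mem C h)

/-- `selectBest` is at least as short as the fallback and every candidate. [cite: Regev2009, Lemma 3.17 (proof: "output the shortest set found")] -/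
theorem maxNormSq_selectBest_le (c₀ : List (List ℤ)) (cands : List (List (List ℤ))) :
    maxNormSq (selectBest c₀ cands) ≤ maxNormSq c₀ ∧ ∀ C ∈ cands, maxNormSq (selectBest c₀ cands) ≤ maxNormSq C := by
  suffices h : ∀ (cands : List (List (List ℤ))) (b : List (List ℤ)),
      maxNormSq (cands.foldl (fun best C => better C best) b) ≤ maxNormSq b ∧
        ∀ C ∈ cands, maxNormSq (cands.foldl (fun best C => better C best) b) ≤ maxNormSq C from h cands c₀
  intro cands
  induction cands with
  | nil => intro b; simp
  | cons C cands ih =>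
    intro b
    rw [List.foldl_cons]
    obtain ⟨h1, h2⟩ := ih (better C b)
    have hb : maxNormSq (better C b) ≤ maxNormSq b ∧ maxNormSq (better C b) ≤ maxNormSq C := by
      rw [better]; split_ifs with h
      · exact ⟨h.le, le_rfl⟩
      · exact ⟨le_rfl, not_lt.1 h⟩
    refine ⟨h1.trans hb.1, fun C' hC' => ?_⟩
    rw [List.mem_cons] at hC'
    rcases hC' with rfl | hC'
    · exact h1.trans hb.2
    · exact h2 C' hC'

/-! ### The post-processing -/

/-- Members of a group candidate pass the membership test. [folklore] -/
theorem memTest_of_mem_groupCandidate {n : ℕ} {B S : List (List ℤ)} {v : List ℤ}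
    (h : v ∈ groupCandidate D n B S) : memTest D B v = true := by
  have := (greedy_sublist D n (S.filter (memTest D B))).subset h
  exact (List.mem_filter.1 this).2

/-- Members of a group candidate come from the group. [folklore] -/
theorem mem_of_mem_groupCandidate {n : ℕ} {B S : List (List ℤ)} {v : List ℤ}
    (h : v ∈ groupCandidate D n B S) : v ∈ S := by
  have := (greedy_sublist D n (S.filter (memTest D B))).subset h
  exact (List.mem_filter.1 this).1

/-- **Specification of the post-processing.** Let `B` be a nonsingular `n × n` integer matrix, let
the fallback `Bl` list `n` linearly independent vectors of the row lattice of `B`, and let the groups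
consist of vectors of length `n`. Then `post D n (rows B) Bl Gs` lists `n` vectors of the row lattice
of `B` (as the rows of a matrix `M`, `M i = zᵢ ᵥ* B`), linearly independent over `ℤ`, whose largest
squared norm is at most that of the fallback and of every admissible group candidate.
[cite: Regev2009, Lemma 3.17 (proof)] -/
theorem post_spec (hD : DetCorrect D) {n : ℕ} (B : Matrix (Fin n) (Fin n) ℤ) (hB : B.det ≠ 0)
    (ML : Matrix (Fin n) (Fin n) ℤ) (hML : LinearIndependent ℤ (fun i => ML i))
    (hMLmem : ∀ i, ∃ z : Fin n → ℤ, z ᵥ* B = ML i)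
    (Gs : List (List (List ℤ))) (hGs : ∀ S ∈ Gs, ∀ v ∈ S, v.length = n) :
    ∃ M : Matrix (Fin n) (Fin n) ℤ, rows M = post D n (rows B) (rows ML) Gs ∧
      LinearIndependent ℤ (fun i => M i) ∧ (∀ i, ∃ z : Fin n → ℤ, z ᵥ* B = M i) ∧
      maxNormSq (rows M) ≤ maxNormSq (rows ML) ∧
      ∀ C ∈ candidates D n (rows B) Gs, maxNormSq (rows M) ≤ maxNormSq C := by
  rw [post]
  obtain ⟨hle0, hleC⟩ := maxNormSq_selectBest_le (rows ML) (candidates D n (rows B) Gs)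
  rcases selectBest_mem (rows ML) (candidates D n (rows B) Gs) with hsel | hsel
  · refine ⟨ML, hsel.symm, hML, hMLmem, le_rfl, fun C hC => ?_⟩
    have := hleC C hC
    rwa [hsel] at this
  · -- a group candidate with `n` vectors
    obtain ⟨T, hT, hsel'⟩ : ∃ T ∈ candidates D n (rows B) Gs, selectBest (rows ML) (candidates D n (rows B) Gs) = T :=
      ⟨_, hsel, rfl⟩
    rw [hsel'] at hle0 hleC ⊢
    obtain ⟨hTmem, hTn⟩ := List.mem_filter.1 hT
    rw [decide_eq_true_iff] at hTn
    obtain ⟨S, hS, rfl⟩ := List.mem_map.1 hTmem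
    have hlenS : ∀ v ∈ S.filter (memTest D (rows B)), v.length = n :=
      fun v hv => hGs S hS v (List.mem_filter.1 hv).1
    obtain ⟨M, hM⟩ := exists_rows (groupCandidate D n (rows B) S) hTn (forall_length_greedy hD _ hlenS)
    rw [← hM] at hle0 hleC
    refine ⟨M, hM, linearIndependent_greedy hD _ M hM, fun i => ?_, hle0, hleC⟩
    have hi : List.ofFn (M i) ∈ groupCandidate D n (rows B) S := by
      rw [← hM, rows, List.mem_ofFn]; exact ⟨i, rfl⟩
    exact (memTest_iff hD B hB (M i)).1 (memTest_of_mem_groupCandidate hi)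

/-- **The output is as short as any good group**: if every vector of a group `S ∈ Gs` (all of
length `n`) is an integer combination of the rows of `B` and the group spans `ℝⁿ`, then the largest
squared norm of the output is at most `max_{s ∈ S} ‖s‖²`. [cite: Regev2009, Lemma 3.17 (proof)] -/
theorem maxNormSq_post_le_of_group (hD : DetCorrect D) {n : ℕ} (B : Matrix (Fin n) (Fin n) ℤ) (hB : B.det ≠ 0)
    (Bl : List (List ℤ)) (Gs : List (List (List ℤ))) {S : List (List ℤ)} (hS : S ∈ Gs)
    (hSn : ∀ v ∈ S, v.length = n) (hSmem : ∀ v ∈ S, ∃ z : Fin n → ℤ, List.ofFn (z ᵥ* B) = v)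
    (hspan : realSpan n S = ⊤) {b : ℤ} (hb : 0 ≤ b) (hSb : ∀ v ∈ S, normSq v ≤ b) :
    maxNormSq (post D n (rows B) Bl Gs) ≤ b := by
  -- every vector of `S` passes the membership test, so the group candidate is `greedy D n S`
  have hfilter : S.filter (memTest D (rows B)) = S := by
    rw [List.filter_eq_self]
    intro v hv
    obtain ⟨z, hz⟩ := hSmem v hv
    rw [← hz, memTest_iff hD B hB]
    exact ⟨z, rfl⟩
  have hcand : groupCandidate D n (rows B) S ∈ candidates D n (rows B) Gs := by
    rw [candidates, List.mem_filter, decide_eq_true_iff]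
    refine ⟨List.mem_map.2 ⟨S, hS, rfl⟩, ?_⟩
    rw [groupCandidate, hfilter]
    exact length_greedy_eq hD S hSn hspan
  refine ((maxNormSq_selectBest_le Bl _).2 _ hcand).trans (maxNormSq_le hb fun v hv => hSb v ?_)
  exact mem_of_mem_groupCandidate hv

end RowSelect

end Literature.LinearAlgebra.Matrix
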